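import Summits.KontsevichZagierPeriods.KontsevichZagierPeriods.Theorems.LiouvilleUnfoldingAyoubPiCancellationBandFinishing
import Summits.KontsevichZagierPeriods.KontsevichZagierPeriods.Theorems.LiouvilleUnfoldingAyoubPiCancellationExteriorAnnihilation
import Summits.KontsevichZagierPeriods.KontsevichZagierPeriods.Theorems.LiouvilleUnfoldingAyoubPiCancellationStubSpreadWeight
import Summits.KontsevichZagierPeriods.KontsevichZagierPeriods.Theorems.LiouvilleUnfoldingAyoubPiCancellationStubSpreadLift
import Summits.KontsevichZagierPeriods.KontsevichZagierPeriods.Theorems.LiouvilleUnfoldingAyoubPiCancellationSpreadSolidReduce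
import Summits.KontsevichZagierPeriods.KontsevichZagierPeriods.Theorems.LiouvilleUnfoldingAyoubPiCancellationSpreadPlaneReduce
import Summits.KontsevichZagierPeriods.KontsevichZagierPeriods.Theorems.LiouvilleUnfoldingAyoubPiCancellationSpreadSegmentConst

/-!
# Crux stmt-KontsevichZagierPeriods-0540 (`LiouvilleUnfolding.AyoubPiCancellation` ≡ `KZ.PiCancellation`),
# line `Sketch` (idea `moving-segment-wronskian`): SPREAD FINISHING (A'), stub `stub_spreadFinishing`

Support file (`--supports` stmt-KontsevichZagierPeriods-0540) of the line skeleton (v8, lead seat c1),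
registered stub `stub_spreadFinishing`. **A `q`-fibred certificate of the moving-segment spread family
finishes, with no derivative engine.**

Objects. The pinned MOVING-SEGMENT SPREAD family over the wall positions `q ∈ (a, b)`:
`V n r = [{(q, x, y, w) : a < q < b, x² + y² ≤ 1, x < q, w ∈ σ_r}, g_r(w)]` (dimension `n + 3`,
coordinate `0 = q`), the spread solid `{(q, x, y) : a < q < b, x² + y² ≤ 1,
x < q} ⊆ ℝ³` (`isSemialgebraic_spreadSolid`, `exists_spreadSolidOne`), and the ZERO-MEAN WEIGHT of
an interior interval `a < a' < b' < b`, `-1 < a' < b' < 1`,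

  `h_{a',b'}(q) = 𝟙_{(a',b')}(q) · ((2q − (a'+b'))(1 − q²) + q (q − a')(q − b')) / (2 (1 − q²) √(1 − q²))`
  `            = d/dq [(q − a')(q − b') / (2√(1 − q²))]` on `(a', b')`, extended by zero.

Theorem (`stub_spreadFinishing`). If `lift (of ∘ V) c ∈ KZ.fibredRelations` (additivity, substitutions
fixing the wall position `z 0 = q`, Newton–Leibniz over bases of dimension `≥ 1`) then
`c ∈ KZ.relations`. Proof: the weight multiplier `M_h [t, f] = [t, h(z 0)·f]`
(`BetaCancellationLine.stub_weightExists` p124624, `exists_weightMul`; admissibility of `h` is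
`stub_spreadWeight` p145443) maps `fibredRelations` into `relations`
(`BetaCancellationLine.stub_weightMul` p124864 with `fibredRelations_le_weightClosure`: a fibred
substitution fixes `q`, hence `h(q)`), computes `[V_h] * c` on the spread family (`stub_spreadLift`
p148297, `V_h = [spread solid, h(q)]`, `exists_weightedSpreadSolid`), and `V_h` is worth the non-zero
rational `(b' − a')³/6` against every factor: `V_h ∼ K` (`stub_spreadSolidReduce` p150192: cut the wall
positions, Newton–Leibniz along `y`, swap `(q, x)`), `K ∼ K_mid = [[a', b'], −(x − a')(x − b')]`
(`stub_spreadPlaneReduce` p151731: Newton–Leibniz along `q` with primitive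
`2√(1 − x²)·(q − a')(q − b')/(2√(1 − q²))`, whose boundary term on the diagonal `q = x` is
`−(x − a')(x − b')` — the chord length cancels the profile), `s × K_mid ∼ ((b' − a')³/6)·s`
(`stub_spreadSegmentConst` p152235), and
`BetaCancellationLine.mem_relations_of_of_mul_mem_of_forall_prod_equivalent` finishes.
Why zero mean: `∫_{a'}^{b'} h = H(b') − H(a') = 0` kills the segment term `[D ∩ {x < a'}] ⊗ c` that
every other weight leaves behind (seat 0's "moments return the same unknowns" covered polynomial and
strip weights only). No definitions; sorry-free; axioms ⊆ {propext, Classical.choice, Quot.sound}.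

References: M. Kontsevich, D. Zagier, *Periods* (2001), §1.2 (rules (1)–(3)), §4.1; J. Ayoub,
*Une version relative de la conjecture des périodes de Kontsevich–Zagier*, Ann. of Math. 181 (2015),
§1 (relations relative to a base).
-/

noncomputable section

-- `Summit.KontsevichZagierPeriods.KontsevichZagierPeriods.…` is the tree's mandated layout (single-conjunct summit).
set_option linter.dupNamespace false

namespace Summit.KontsevichZagierPeriods.KontsevichZagierPeriods.AyoubPiCancellationLine

open Set MeasureTheory
open Literature.NumberTheory.Transcendental
open Literature.NumberTheory.Transcendental.KZ
open Literature.ModelTheory.ExponentialFields (IsSemialgebraic)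
open MvPolynomial (X C)
open Summit.KontsevichZagierPeriods.KontsevichZagierPeriods.BetaCancellationLine
  (stub_weightExists exists_weightMul stub_weightMul
    mem_relations_of_of_mul_mem_of_forall_prod_equivalent)

/-! ### The spread solid and the pinned spread family -/

/-- The spread solid `{(q, x, y) : a < q < b, x² + y² ≤ 1, x < q} ⊆ ℝ³` is `ℚ`-semialgebraic
(polynomial inequalities with rational coefficients). [folklore] -/
theorem isSemialgebraic_spreadSolid (a b : ℚ) :
    IsSemialgebraic ℚ {z : Fin 3 → ℝ | ((a : ℝ) < z 0 ∧ z 0 < b) ∧ z 1 ^ 2 + z 2 ^ 2 ≤ 1 ∧ z 1 < z 0} := by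
  have h1 : IsSemialgebraic ℚ (paramSlab 2 a b) := isSemialgebraic_paramSlab 2 a b
  have h2 : IsSemialgebraic ℚ {z : Fin 3 → ℝ | z 1 ^ 2 + z 2 ^ 2 ≤ 1} := by
    have := Literature.ModelTheory.ExponentialFields.isSemialgebraic_setOf_eval_le
      (k := ℚ) (R := ℝ) (X 1 ^ 2 + X 2 ^ 2 : MvPolynomial (Fin 3) ℚ) 1
    simpa using this
  have h3 : IsSemialgebraic ℚ {z : Fin 3 → ℝ | z 1 < z 0} := by
    have := Literature.ModelTheory.ExponentialFields.isSemialgebraic_setOf_eval_lt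
      (k := ℚ) (R := ℝ) (X 1 : MvPolynomial (Fin 3) ℚ) (X 0)
    simpa using this
  convert (h1.inter h2).inter h3 using 1
  ext z
  simp only [mem_inter_iff, mem_setOf_eq, mem_paramSlab, and_assoc]

/-- **The unit spread solid exists**: `[{a < q < b, x² + y² ≤ 1, x < q}, 1] : IntegralRep 3`, the
restriction of the interval prepend `[(a, b) × D, 1]` of the disc (`extAnn_exists_prepend`,
p142310) to the `ℚ`-semialgebraic subset `{x < q}`. [folklore] -/
theorem exists_spreadSolidOne (a b : ℚ) :
    ∃ X : IntegralRep 3,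
      X.domain = {z : Fin 3 → ℝ | ((a : ℝ) < z 0 ∧ z 0 < b) ∧ z 1 ^ 2 + z 2 ^ 2 ≤ 1 ∧ z 1 < z 0} ∧
      X.integrand = fun _ => 1 := by
  obtain ⟨Q, hQ⟩ := extAnn_exists_prepend a b
  have hsub : {z : Fin 3 → ℝ | ((a : ℝ) < z 0 ∧ z 0 < b) ∧ z 1 ^ 2 + z 2 ^ 2 ≤ 1 ∧ z 1 < z 0} ⊆
      (Q 2 piRep).domain := by
    rw [(hQ 2 piRep).1]
    rintro z ⟨hz0, hd, -⟩
    refine ⟨hz0, ?_⟩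
    simpa [Fin.succ_zero_eq_one, Fin.succ_one_eq_two] using hd
  refine ⟨(Q 2 piRep).restrict _ (isSemialgebraic_spreadSolid a b) hsub, rfl, ?_⟩
  rw [IntegralRep.integrand_restrict, (hQ 2 piRep).2]
  rfl

/-- **The weighted spread solid exists** for every weight whose weighted companions exist: the
companion of the unit spread solid, repackaged with integrand `w (z 0)` (`w (z 0) * 1`).
[folklore] -/
theorem exists_weightedSpreadSolid (a b : ℚ) (w : ℝ → ℝ)
    (hex : ∀ (k : ℕ) (r : IntegralRep (k + 1)),
      ∃ s : IntegralRep (k + 1), s.domain = r.domain ∧ s.integrand = fun z => w (z 0) * r.integrand z) :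
    ∃ Vw : IntegralRep 3,
      Vw.domain = {z : Fin 3 → ℝ | ((a : ℝ) < z 0 ∧ z 0 < b) ∧ z 1 ^ 2 + z 2 ^ 2 ≤ 1 ∧ z 1 < z 0} ∧
      Vw.integrand = fun z => w (z 0) := by
  obtain ⟨X, hXd, hXi⟩ := exists_spreadSolidOne a b
  obtain ⟨s, hs, hsi⟩ := hex 2 X
  have hsa : IsSemialgebraicFunOn ℚ
      {z : Fin 3 → ℝ | ((a : ℝ) < z 0 ∧ z 0 < b) ∧ z 1 ^ 2 + z 2 ^ 2 ≤ 1 ∧ z 1 < z 0}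
      (fun z => w (z 0)) := by
    have h := s.isSemialgebraicFunOn_integrand
    rw [hs, hsi, hXd, hXi] at h
    simpa using h
  have hint : IntegrableOn (fun z : Fin 3 → ℝ => w (z 0))
      {z : Fin 3 → ℝ | ((a : ℝ) < z 0 ∧ z 0 < b) ∧ z 1 ^ 2 + z 2 ^ 2 ≤ 1 ∧ z 1 < z 0} := by
    have h := s.integrableOn
    rw [hs, hsi, hXd, hXi] at h
    simpa using h
  exact ⟨⟨_, _, isSemialgebraic_spreadSolid a b, hsa, hint⟩, rfl, rfl⟩

/-- **STUB `stub_spreadFinishing` — (A') SPREAD FINISHING** (proved): a `q`-FIBRED certificate for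
the pinned spread family of `c` over a wall interval `(a, b)` containing an interior interval
`a < a' < b' < b`, `-1 < a' < b' < 1`, forces `c ∈ relations`. The multiplier of the zero-mean
weight `h_{a',b'}` (`stub_spreadWeight`, `BetaCancellationLine.stub_weightExists`,
`exists_weightMul`) kills the fibred certificate (`stub_weightMul`,
`fibredRelations_le_weightClosure`), computes `[V_h] * c` on it (`stub_spreadLift`), and `V_h` is
worth `(b' − a')³/6 ≠ 0` against every factor (`stub_spreadSolidReduce`, `stub_spreadPlaneReduce`,
`KZ.Equivalent.prod`, `stub_spreadSegmentConst`), so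
`BetaCancellationLine.mem_relations_of_of_mul_mem_of_forall_prod_equivalent` finishes. No derivative
of the family is taken (the "derivative engine" of the idea card is unnecessary). [folklore] -/
theorem stub_spreadFinishing : ∀ (a b a' b' : ℚ), a < a' → a' < b' → b' < b → -1 < a' → b' < 1 →
    ∀ (V : ∀ n : ℕ, IntegralRep n → IntegralRep (n + 3)),
      (∀ (n : ℕ) (r : IntegralRep n),
        (V n r).domain = {z : Fin (n + 3) → ℝ | ((a : ℝ) < z 0 ∧ z 0 < b) ∧ z 1 ^ 2 + z 2 ^ 2 ≤ 1 ∧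
          z 1 < z 0 ∧ (fun i : Fin n => z i.succ.succ.succ) ∈ r.domain} ∧
        (V n r).integrand = fun z => r.integrand (fun i : Fin n => z i.succ.succ.succ)) →
      ∀ c : FormalRep,
        FreeAbelianGroup.lift (fun s : (Σ n, IntegralRep n) => of (V s.1 s.2)) c ∈ fibredRelations →
          c ∈ relations := by
  intro a b a' b' haa hab hbb ha hb V hV c hc
  -- the admissible zero-mean weight and its multiplier
  obtain ⟨hw, C, hC⟩ := stub_spreadWeight a' b' ha hab hb
  set w : ℝ → ℝ := (Set.Ioo (a' : ℝ) b').indicator (fun t => ((2 * t - (a' + b')) * (1 - t ^ 2) +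
    t * ((t - a') * (t - b'))) / (2 * (1 - t ^ 2) * Real.sqrt (1 - t ^ 2))) with hw_def
  have hex := stub_weightExists w hw C hC
  obtain ⟨M, h0, hpin⟩ := exists_weightMul w hex
  -- (1) `M` kills the fibred certificate
  have h1 : M (FreeAbelianGroup.lift (fun s : (Σ n, IntegralRep n) => of (V s.1 s.2)) c) ∈
      relations :=
    stub_weightMul w hw hex M h0 hpin _ (fibredRelations_le_weightClosure w hc)
  -- (2) on the spread family `M` computes `[V_w] * c`
  obtain ⟨Vw, hVwd, hVwi⟩ := exists_weightedSpreadSolid a b w hex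
  have h2 := stub_spreadLift a b w hex V hV Vw hVwd hVwi M hpin c
  have h3 : of Vw * c ∈ relations := by
    simpa using relations.add_mem h2 h1
  -- (3) the weighted spread solid is worth `(b' - a')³/6 ≠ 0` against every factor
  obtain ⟨K, hKd, hKi, hVK⟩ := stub_spreadSolidReduce a b a' b' haa hab hbb ha hb hw C hC
  obtain ⟨Kmid, hMd, hMi, hKM⟩ := stub_spreadPlaneReduce a' b' ha hab hb hw C hC
  have hκ : IsAlgebraic ℚ (((b' - a') ^ 3 / 6 : ℚ) : ℝ) := by
    have h := isAlgebraic_algebraMap (R := ℚ) (A := ℝ) ((b' - a') ^ 3 / 6 : ℚ)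
    rwa [eq_ratCast] at h
  have hκ0 : (((b' - a') ^ 3 / 6 : ℚ) : ℝ) ≠ 0 := by
    have h : (0 : ℚ) < (b' - a') ^ 3 / 6 := by
      have := sub_pos.2 hab
      positivity
    exact_mod_cast h.ne'
  have hfin : ∀ (m : ℕ) (s : IntegralRep m),
      Equivalent (s.prod Vw) (s.constMul (((b' - a') ^ 3 / 6 : ℚ) : ℝ) hκ) := fun m s =>
    (Equivalent.prod (Equivalent.refl s) ((hVK Vw hVwd (by rw [hVwi])).trans (hKM K hKd hKi))).trans
      (stub_spreadSegmentConst a' b' hab Kmid hMd hMi hκ m s)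
  exact mem_relations_of_of_mul_mem_of_forall_prod_equivalent Vw hκ hκ0 hfin c h3


end Summit.KontsevichZagierPeriods.KontsevichZagierPeriods.AyoubPiCancellationLine
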